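import Mathlib
import Literature.Combinatorics.Additive.TripleProductProperty
import Summits.MatrixMultiplication.MatrixMultiplication.Theorems.SnSubsetDichotomyPolynomialSlackCosetFibring
import Summits.MatrixMultiplication.MatrixMultiplication.Theorems.SnSubsetDichotomyPolynomialSlackPrintRegime
import Summits.MatrixMultiplication.MatrixMultiplication.Theorems.SnSubsetDichotomyPolynomialSlackStubRelativeMixing
import Summits.MatrixMultiplication.MatrixMultiplication.Theorems.SnSubsetDichotomyPolynomialSlackCommonValueFibring

/-!
# Two-point fibring cap for TPP triples in `S_n`

Crux `Summit.MatrixMultiplication.MatrixMultiplication.Theses.SnSubsetDichotomy.PolynomialSlack`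
(item `stmt-MatrixMultiplication-8306`), helper file of lead c5 (line `transport-split-hull`), the
TWO-point version of the common-value fibring cap (`commonValue_volume_le`): when two members of a TPP
triple `(S, T, U)` of `S_n` are restricted to point bumps at TWO common values `v₁ ≠ v₂`
(`{s : s i₁ = v₁ ∧ s i₂ = v₂}`, `{t : t j₁ = v₁ ∧ t j₂ = v₂}`), fibring over the pointwise stabiliser
`Stab(v₁) ⊓ Stab(v₂) ≅ S_{n-2}` (`tpp_card_mul_mul_le_cosets` with the labelling
`x ↦ (x⁻¹ v₁, x⁻¹ v₂)`) loses only the index `n (n - 1)`: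

* `tpp_volume_le_of_twoPointStabilizer` — a bound `B` on TPP volumes in `S_{n-2}` bounds the volume of
  every TPP triple of `S_n` inside `Stab(v₁) ⊓ Stab(v₂)` (transport by `exists_stabiliser_transport`
  with `t = 2`, `tpp_pullback`, `card_pullback`);
* `commonValues_two_volume_le` — `|S ∩ {s i₁ = v₁, s i₂ = v₂}|·|T ∩ {t j₁ = v₁, t j₂ = v₂}|·|U|
  ≤ n (n - 1) · B` (the two restricted members have a single label each, `U` has at most
  `|univ.offDiag| = n (n - 1)` labels);
* `commonValues_two_volume_le_explicit` — the same with the explicit BCGPU value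
  `B = ⌊((n-2)!)^{3/2}/√⌊(n-2)/4⌋ + (n-2)!⌋` (`tpp_volume_le_perm` two dimensions down, `n ≥ 7`).
-/

namespace Summit.MatrixMultiplication.MatrixMultiplication.Theorems.PolynomialSlack

open scoped BigOperators
open Literature.Combinatorics.Additive (TripleProductProperty)

set_option linter.dupNamespace false

/-! ## The two-point stabiliser and its labelling -/

/-- Membership in the two-point stabiliser `Stab(v₁) ⊓ Stab(v₂)`: `σ v₁ = v₁` and `σ v₂ = v₂`.
[folklore] -/
theorem mem_stabilizer_inf_stabilizer_iff {n : ℕ} (v₁ v₂ : Fin n) (σ : Equiv.Perm (Fin n)) :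
    σ ∈ MulAction.stabilizer (Equiv.Perm (Fin n)) v₁ ⊓ MulAction.stabilizer (Equiv.Perm (Fin n)) v₂ ↔
      σ v₁ = v₁ ∧ σ v₂ = v₂ := by
  rw [Subgroup.mem_inf, MulAction.mem_stabilizer_iff, MulAction.mem_stabilizer_iff,
    Equiv.Perm.smul_def, Equiv.Perm.smul_def]

/-- Right cosets of `Stab(v₁) ⊓ Stab(v₂)` in `S_n` are the fibres of `x ↦ (x⁻¹ v₁, x⁻¹ v₂)`: if the two
labels agree then `x y⁻¹` fixes `v₁` and `v₂`. [folklore] -/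
theorem mul_inv_mem_stabilizer_inf_of_label_eq {n : ℕ} (v₁ v₂ : Fin n) (x y : Equiv.Perm (Fin n))
    (hxy : (x⁻¹ v₁, x⁻¹ v₂) = (y⁻¹ v₁, y⁻¹ v₂)) :
    x * y⁻¹ ∈
      MulAction.stabilizer (Equiv.Perm (Fin n)) v₁ ⊓ MulAction.stabilizer (Equiv.Perm (Fin n)) v₂ := by
  obtain ⟨h1, h2⟩ := Prod.mk.inj hxy
  exact Subgroup.mem_inf.2 ⟨mul_inv_mem_stabilizer_of_inv_apply_eq v₁ x y h1,
    mul_inv_mem_stabilizer_of_inv_apply_eq v₂ x y h2⟩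

/-- The pair `![v₁, v₂]` is an injective `2`-tuple when `v₁ ≠ v₂`. [folklore] -/
theorem injective_vecCons_two {n : ℕ} {v₁ v₂ : Fin n} (hv : v₁ ≠ v₂) :
    Function.Injective (![v₁, v₂] : Fin 2 → Fin n) := by
  intro a b hab
  fin_cases a <;> fin_cases b
  · rfl
  · exact absurd (by simpa using hab) hv
  · exact absurd (by simpa using hab) hv.symm
  · rfl

/-! ## TPP volumes inside the two-point stabiliser -/

/-- **TPP volumes inside a two-point stabiliser are TPP volumes of `S_{n-2}`.** If `B` bounds
`|S'||T'||U'|` for every TPP triple of `S_{n-2}`, then it bounds the volume of every TPP triple of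
`S_n` all of whose members fix `v₁` and `v₂` (`v₁ ≠ v₂`): transport
`Stab(v₁) ⊓ Stab(v₂) ≅ S_{n-2}` by the tree's `exists_stabiliser_transport` with `t = 2`, pull the
TPP back along the injective homomorphism (`tpp_pullback`) and count with `card_pullback`.
[folklore] -/
theorem tpp_volume_le_of_twoPointStabilizer {n : ℕ} {v₁ v₂ : Fin n} (hv : v₁ ≠ v₂) (B : ℕ)
    (hB : ∀ S' T' U' : Finset (Equiv.Perm (Fin (n - 2))), TripleProductProperty S' T' U' →
      S'.card * T'.card * U'.card ≤ B)
    (S T U : Finset (Equiv.Perm (Fin n)))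
    (hS : ∀ x ∈ S, x ∈
      MulAction.stabilizer (Equiv.Perm (Fin n)) v₁ ⊓ MulAction.stabilizer (Equiv.Perm (Fin n)) v₂)
    (hT : ∀ x ∈ T, x ∈
      MulAction.stabilizer (Equiv.Perm (Fin n)) v₁ ⊓ MulAction.stabilizer (Equiv.Perm (Fin n)) v₂)
    (hU : ∀ x ∈ U, x ∈
      MulAction.stabilizer (Equiv.Perm (Fin n)) v₁ ⊓ MulAction.stabilizer (Equiv.Perm (Fin n)) v₂)
    (h : TripleProductProperty S T U) : S.card * T.card * U.card ≤ B := by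
  classical
  obtain ⟨ψ, ι, hψ, -, -, -, -, hsurj⟩ :=
    exists_stabiliser_transport (n := n) (t := 2) ![v₁, v₂] (injective_vecCons_two hv)
  have hfix : ∀ σ : Equiv.Perm (Fin n),
      σ ∈ MulAction.stabilizer (Equiv.Perm (Fin n)) v₁ ⊓ MulAction.stabilizer (Equiv.Perm (Fin n)) v₂ →
        ∀ k, σ (![v₁, v₂] k) = ![v₁, v₂] k := by
    intro σ hσ
    obtain ⟨h1, h2⟩ := (mem_stabilizer_inf_stabilizer_iff v₁ v₂ σ).1 hσ
    exact Fin.forall_fin_two.2 ⟨by simpa using h1, by simpa using h2⟩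
  have himS : ∀ σ ∈ S, ∃ π, ψ π = σ := fun σ hσ => hsurj σ (hfix σ (hS σ hσ))
  have himT : ∀ σ ∈ T, ∃ π, ψ π = σ := fun σ hσ => hsurj σ (hfix σ (hT σ hσ))
  have himU : ∀ σ ∈ U, ∃ π, ψ π = σ := fun σ hσ => hsurj σ (hfix σ (hU σ hσ))
  have htpp := tpp_pullback (ψ := ψ) hψ h
  have hvol := hB _ _ _ htpp
  rwa [card_pullback hψ himS, card_pullback hψ himT, card_pullback hψ himU] at hvol

/-- **Two-point fibring in `S_n`.** For `v₁ ≠ v₂` and every bound `B` on the volumes of TPP triples of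
`S_{n-2}`, every TPP triple `(S,T,U)` of `S_n` satisfies
`|S||T||U| ≤ |ℓ(S)|·|ℓ(T)|·|ℓ(U)| · B` for the labelling `ℓ x = (x⁻¹ v₁, x⁻¹ v₂)`, whose fibres are the
right cosets of `Stab(v₁) ⊓ Stab(v₂)` (`tpp_card_mul_mul_le_cosets`). [folklore] -/
theorem tpp_card_mul_mul_le_twoPointFibres {n : ℕ} {v₁ v₂ : Fin n} (hv : v₁ ≠ v₂) (B : ℕ)
    (hB : ∀ S' T' U' : Finset (Equiv.Perm (Fin (n - 2))), TripleProductProperty S' T' U' →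
      S'.card * T'.card * U'.card ≤ B)
    {S T U : Finset (Equiv.Perm (Fin n))} (h : TripleProductProperty S T U) :
    S.card * T.card * U.card ≤
      (S.image fun x => (x⁻¹ v₁, x⁻¹ v₂)).card * (T.image fun x => (x⁻¹ v₁, x⁻¹ v₂)).card *
        (U.image fun x => (x⁻¹ v₁, x⁻¹ v₂)).card * B :=
  tpp_card_mul_mul_le_cosets
    (MulAction.stabilizer (Equiv.Perm (Fin n)) v₁ ⊓ MulAction.stabilizer (Equiv.Perm (Fin n)) v₂)
    (fun x => (x⁻¹ v₁, x⁻¹ v₂)) (mul_inv_mem_stabilizer_inf_of_label_eq v₁ v₂) B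
    (fun S' T' U' hS' hT' hU' h' =>
      tpp_volume_le_of_twoPointStabilizer hv B hB S' T' U' hS' hT' hU' h') h

/-! ## Counting labels -/

/-- A two-point bump `{x ∈ X : x i₁ = v₁ ∧ x i₂ = v₂}` has a single label: its image under
`x ↦ (x⁻¹ v₁, x⁻¹ v₂)` lies in `{(i₁, i₂)}`, so has at most one element. [folklore] -/
theorem card_image_inv_apply_two_filter_le_one {n : ℕ} (X : Finset (Equiv.Perm (Fin n)))
    (i₁ i₂ v₁ v₂ : Fin n) :
    ((X.filter fun x => x i₁ = v₁ ∧ x i₂ = v₂).image fun x => (x⁻¹ v₁, x⁻¹ v₂)).card ≤ 1 := by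
  refine (Finset.card_le_card ?_).trans (Finset.card_singleton (i₁, i₂)).le
  intro a ha
  simp only [Finset.mem_image, Finset.mem_filter] at ha
  obtain ⟨x, ⟨-, hx₁, hx₂⟩, rfl⟩ := ha
  exact Finset.mem_singleton.2 (Prod.ext (Equiv.Perm.inv_eq_iff_eq.2 hx₁.symm)
    (Equiv.Perm.inv_eq_iff_eq.2 hx₂.symm))

/-- For `v₁ ≠ v₂`, any set of permutations of `Fin n` has at most `n (n - 1)` distinct labels
`(x⁻¹ v₁, x⁻¹ v₂)`: they lie off the diagonal of `Fin n × Fin n`. [folklore] -/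
theorem card_image_inv_apply_two_le {n : ℕ} (X : Finset (Equiv.Perm (Fin n))) {v₁ v₂ : Fin n}
    (hv : v₁ ≠ v₂) : (X.image fun x => (x⁻¹ v₁, x⁻¹ v₂)).card ≤ n * (n - 1) := by
  have hsub : (X.image fun x => (x⁻¹ v₁, x⁻¹ v₂)) ⊆ (Finset.univ : Finset (Fin n)).offDiag := by
    intro a ha
    simp only [Finset.mem_image] at ha
    obtain ⟨x, -, rfl⟩ := ha
    exact Finset.mem_offDiag.2 ⟨Finset.mem_univ _, Finset.mem_univ _,
      fun hx => hv (x⁻¹.injective hx)⟩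
  refine (Finset.card_le_card hsub).trans ?_
  rw [Finset.offDiag_card, Finset.card_univ, Fintype.card_fin, Nat.mul_sub_one]

/-! ## The two-point fibring cap -/

/-- **Two-point fibring cap (abstract bound two dimensions down).** If `B` bounds the volume
`|S'||T'||U'|` of every TPP triple of `S_{n-2}`, then for every TPP triple `(S, T, U)` of `S_n`, all
values `v₁ ≠ v₂` and all positions `i₁, i₂, j₁, j₂`:
`|{s ∈ S : s i₁ = v₁, s i₂ = v₂}|·|{t ∈ T : t j₁ = v₁, t j₂ = v₂}|·|U| ≤ n (n - 1) · B` — two-point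
fibring over `Stab(v₁) ⊓ Stab(v₂)` (`tpp_card_mul_mul_le_twoPointFibres`) applied to the sub-triple,
whose first two members have exactly one label (`(i₁, i₂)`, resp. `(j₁, j₂)`) while `U` has at most
`n (n - 1)`. [folklore] -/
theorem commonValues_two_volume_le {n : ℕ} {v₁ v₂ : Fin n} (hv : v₁ ≠ v₂) (B : ℕ)
    (hB : ∀ S' T' U' : Finset (Equiv.Perm (Fin (n - 2))), TripleProductProperty S' T' U' →
      S'.card * T'.card * U'.card ≤ B)
    {S T U : Finset (Equiv.Perm (Fin n))} (h : TripleProductProperty S T U) (i₁ i₂ j₁ j₂ : Fin n) :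
    (S.filter fun s => s i₁ = v₁ ∧ s i₂ = v₂).card * (T.filter fun t => t j₁ = v₁ ∧ t j₂ = v₂).card *
      U.card ≤ n * (n - 1) * B := by
  have hsub : TripleProductProperty (S.filter fun s => s i₁ = v₁ ∧ s i₂ = v₂)
      (T.filter fun t => t j₁ = v₁ ∧ t j₂ = v₂) U :=
    h.mono (Finset.filter_subset _ _) (Finset.filter_subset _ _) subset_rfl
  have hS := card_image_inv_apply_two_filter_le_one S i₁ i₂ v₁ v₂
  have hT := card_image_inv_apply_two_filter_le_one T j₁ j₂ v₁ v₂
  have hU := card_image_inv_apply_two_le U hv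
  calc (S.filter fun s => s i₁ = v₁ ∧ s i₂ = v₂).card *
        (T.filter fun t => t j₁ = v₁ ∧ t j₂ = v₂).card * U.card
      ≤ ((S.filter fun s => s i₁ = v₁ ∧ s i₂ = v₂).image fun x => (x⁻¹ v₁, x⁻¹ v₂)).card *
          ((T.filter fun t => t j₁ = v₁ ∧ t j₂ = v₂).image fun x => (x⁻¹ v₁, x⁻¹ v₂)).card *
          (U.image fun x => (x⁻¹ v₁, x⁻¹ v₂)).card * B :=
        tpp_card_mul_mul_le_twoPointFibres hv B hB hsub
    _ ≤ 1 * 1 * (n * (n - 1)) * B :=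
        Nat.mul_le_mul (Nat.mul_le_mul (Nat.mul_le_mul hS hT) hU) le_rfl
    _ = n * (n - 1) * B := by ring

/-- **Two-point fibring cap, explicit (BCGPU two dimensions down).** For `n ≥ 7`, every TPP triple
`(S, T, U)` of `S_n`, all values `v₁ ≠ v₂` and all positions `i₁, i₂, j₁, j₂`:
`|{s ∈ S : s i₁ = v₁, s i₂ = v₂}|·|{t ∈ T : t j₁ = v₁, t j₂ = v₂}|·|U|
≤ n (n - 1) · (((n-2)!)^{3/2}/√⌊(n-2)/4⌋ + (n-2)!)` — `commonValues_two_volume_le` with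
`B = ⌊((n-2)!)^{3/2}/√⌊(n-2)/4⌋ + (n-2)!⌋`, a valid bound on TPP volumes in `S_{n-2}` by
`tpp_volume_le_perm` (`n - 2 ≥ 5`). [cite: BlasiakCohnGrochowPrattUmans2023, Thm. 3.2] -/
theorem commonValues_two_volume_le_explicit {n : ℕ} (hn : 7 ≤ n) {v₁ v₂ : Fin n} (hv : v₁ ≠ v₂)
    {S T U : Finset (Equiv.Perm (Fin n))} (h : TripleProductProperty S T U) (i₁ i₂ j₁ j₂ : Fin n) :
    (((S.filter fun s => s i₁ = v₁ ∧ s i₂ = v₂).card * (T.filter fun t => t j₁ = v₁ ∧ t j₂ = v₂).card *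
      U.card : ℕ) : ℝ) ≤
      n * (n - 1) * (((n - 2).factorial : ℝ) ^ (3 / 2 : ℝ) / Real.sqrt (((n - 2) / 4 : ℕ) : ℝ) +
        (n - 2).factorial) := by
  have hn' : 5 ≤ n - 2 := by omega
  have key : (((S.filter fun s => s i₁ = v₁ ∧ s i₂ = v₂).card *
      (T.filter fun t => t j₁ = v₁ ∧ t j₂ = v₂).card * U.card : ℕ) : ℝ) ≤
      ((n * (n - 1) : ℕ) : ℝ) * (((n - 2).factorial : ℝ) ^ (3 / 2 : ℝ) /
        Real.sqrt (((n - 2) / 4 : ℕ) : ℝ) + (n - 2).factorial) :=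
    cast_le_mul_of_le_mul_natFloor (by positivity) (commonValues_two_volume_le hv _
      (fun S' T' U' h' => Nat.le_floor (tpp_volume_le_perm hn' S' T' U' h')) h i₁ i₂ j₁ j₂)
  have hcast : ((n * (n - 1) : ℕ) : ℝ) = (n : ℝ) * ((n : ℝ) - 1) := by
    rw [Nat.cast_mul, Nat.cast_sub (by omega : 1 ≤ n), Nat.cast_one]
  rwa [hcast] at key

end Summit.MatrixMultiplication.MatrixMultiplication.Theorems.PolynomialSlack
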